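import Summits.QuantumFields.YangMills.Theorems.BalabanUVNodesN21GappedTopReading13CoPHDefs
import Summits.QuantumFields.YangMills.Theorems.BalabanUVNodesN21TopLetteredReading13CoPHSanity

/-!
# N21 (NE7c) · THE GAPPED TOP CUT — SANITY (A-guards): at EQUAL letters the gapped step weights ARE T1's top-lettered step weights and the two-sided collar shell VANISHES; at ZERO
# width the gapped reading's shell parts vanish identically (the zero-width instance is the zero split); depth budget `0` selects depth `0`; the gapped reading shares every
# non-weight field with dag-n20-d's `crOfRecord₁₃VAt` (`rfl`)

R134 seat `pub-ymgap-dag-n21-d` (g11), node N21 = NE7c, strategy s2; lane K3⁷ `SpineGivenEndpointR13SepCoPH` (stmt-QuantumFields-20544, `--supports … --as helper`;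
COUNT-NEUTRAL).  Imports U5 `…GappedTopReading13CoPHDefs` (the reading) and R4 `…TopLetteredReading13CoPHSanity` (p613684: `cutGrid_width_zero`).

WHAT THIS FILE PROVES (theorems only; 0 `def`).  §40 `ωGapAt_self` ∕ ★ `wGapAt_self_top` (`k + 1 = p.K ⇒ wGap(θ, θ) = wTop(θ)`), `topGapSlotAt_self`, `topGapCoreAt_self`,
★ `topGapShellAt_self_eq_zero`, `topGapShellAtLevel_self_eq_zero` (at the run's top); §41 ★ `gapShellA₁₃_eq_zero_of_width_zero` ∕ `gapShellB₁₃_eq_zero_of_width_zero` (`ρ_K = 0`),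
`selGapDepth₁₃_budget_zero`; the `rfl` dictionary `crGap₁₃VAt_{T,Bad,vol,l₀,K₀}_eq` against `crOfRecord₁₃VAt`; ★★ `crGap₁₃VAt_core_eq` (the reading's cores ARE U5's
keyed gapped cores `gapCoreA₁₃ ∕ gapCoreB₁₃`) (the weights `A ∕ B ∕ shA ∕ shB` are NOT claimed equal — they differ:
top-lettered at the selected letter vs print's `ε`).

HONEST FRAMING (binding).  A-guards only: the degenerate instances (`θlo = θ = θhi`, `ρ_K = 0`, `n_K = 0`) are the theorems' subjects; the content regime `0 < ρ_K < 1`, `n_K ≥ 1`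
is NOT covered here (U2–U6); NO estimate; NE7c NOT PRINTED ∕ NOT proved at print's thresholds; N21 NOT discharged; K3⁷ NOT claimed; counts UNMOVED (typed 28∕28 · discharged 5∕27);
never a count claim.  No `instance`, no `notation`, no `def`.  One finite four-torus programme at fixed `ε` — NOT ℝ⁴, NOT OS, NOT a mass gap, NOT the Clay problem.
-/

noncomputable section

open scoped BigOperators
open Finset MeasureTheory

namespace Summit.QuantumFields.YangMills.Theorems.N21ShellSplitOfRecord13CoPH

open Literature.MathematicalPhysics.QuantumFieldTheory.Balaban1983to89
open Literature.MathematicalPhysics.QuantumFieldTheory.Balaban1983to89.T4Continuum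
open Literature.MathematicalPhysics.QuantumFieldTheory.Balaban1983to89.Node00
open YMDAG.UVSplit (SpineReading₁₃CoPH ShellSplit₁₃CoPH crOfRecord₁₃VAt keyA₁₃ keyB₁₃ runA₁₃ runB₁₃ histA₁₃ histB₁₃ classSet₁₃ badClass₁₃)

/-! ## §40 At equal letters: the gapped objects ARE T1's top-lettered objects, the collar shell vanishes -/

section Generality

variable (F : T4Family) (N : ℕ) [NeZero N] (ϑ : Stage9Params F N) (D : FiniteEpsData F (SU N)) (g₀ : ℕ → ℝ) (os : List (ULoop F))
  (p : B12.RunParams) (g : ℕ → ℝ) (k : ℕ)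

/-- at equal letters the gapped label weight IS def-T's label weight at that letter (definitional: `aGapAt ε ε = aWeightAt ε`). [bookkeeping] -/
theorem ωGapAt_self (θ δ' : ℝ) :
    ωGapAt F N ϑ.ν ϑ.τ9.M p g k θ θ δ' ϑ.ζ = ωOfRecordAt F N ϑ.ν ϑ.τ9.M p g k θ δ' ϑ.ζ := rfl

/-- ★ **AT EQUAL LETTERS AND AT THE RUN's TOP THE GAPPED STEP WEIGHTS ARE T1's TOP-LETTERED STEP WEIGHTS**: `k + 1 = p.K ⇒ wGap(θ, θ) p g k = wTop(θ) p g k`. [bookkeeping] -/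
theorem wGapAt_self_top (hk : k + 1 = p.K) (θ : ℝ) : wGapAt F N ϑ θ θ p g k = wTopAt F N ϑ θ p g k := by
  have htop : topLetter ϑ.ν θ p g (k + 1) = θ := by rw [hk]; exact topLetter_top ϑ.ν θ p g
  rw [wGapAt_apply, wTopAt_apply, htop]
  rfl

/-- at equal letters and at the top the gapped top slot IS T1's top-lettered slot. [bookkeeping] -/
theorem topGapSlotAt_self (hk : k + 1 = p.K) (θ t : ℝ) (s' : SeqOfRecord F ϑ.ν ϑ.τ9.M g p.K (k + 1)) :
    topGapSlotAt F N ϑ D g₀ os p g k θ θ t s' = topSlotAt F N ϑ D g₀ os p g k θ t s' := by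
  funext V
  rw [topGapSlotAt_apply, topSlotAt_apply, wGapAt_self_top F N ϑ p g k hk θ]

/-- at equal letters and at the top the gapped core IS the top-lettered class weight. [bookkeeping] -/
theorem topGapCoreAt_self (hk : k + 1 = p.K) (θ t : ℝ) (s' : SeqOfRecord F ϑ.ν ϑ.τ9.M g p.K (k + 1)) :
    topGapCoreAt F N ϑ D g₀ os p g k θ θ t s' = topClassWeightAt F N ϑ D g₀ os p g k θ t s' := by
  unfold topGapCoreAt topClassWeightAt
  exact integral_congr_ae (ae_of_all _ fun V => by rw [topGapSlotAt_self F N ϑ D g₀ os p g k hk θ t s'])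

/-- ★ **AT EQUAL LETTERS THE TWO-SIDED COLLAR SHELL VANISHES** (at the run's top): the empty collar carries no mass. [bookkeeping] -/
theorem topGapShellAt_self_eq_zero (hk : k + 1 = p.K) (θ t : ℝ) (s' : SeqOfRecord F ϑ.ν ϑ.τ9.M g p.K (k + 1)) :
    topGapShellAt F N ϑ D g₀ os p g k θ θ θ t s' = 0 := by
  rw [topGapShellAt, topGapCoreAt_self F N ϑ D g₀ os p g k hk θ t s', sub_self]

variable {k} in
/-- the same at every level `j = p.K`. [bookkeeping] -/
theorem topGapShellAtLevel_self_eq_zero (θ t : ℝ) :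
    ∀ (j : ℕ), j = p.K → ∀ s : SeqOfRecord F ϑ.ν ϑ.τ9.M g p.K j, topGapShellAtLevel F N ϑ D g₀ os p g θ θ θ t j s = 0
  | 0, _, _ => rfl
  | k + 1, hk, s' => topGapShellAt_self_eq_zero F N ϑ D g₀ os p g k hk θ t s'

end Generality

/-! ## §41 At the reading: zero width ⇒ zero shells; budget `0` ⇒ depth `0`; the `rfl` dictionary against n20-d's reading -/

section Reading

variable {F : T4Family} {N : ℕ} [NeZero N]

/-- ★ **AT ZERO WIDTH RUN A's GAPPED SHELL PART VANISHES IDENTICALLY** (every key, every depth budget): all three letters are the run's own `ε`, the collar is empty — the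
zero-width instance of the reading is the zero split (A6: the content regime is `0 < ρ_K`). [bookkeeping] -/
theorem gapShellA₁₃_eq_zero_of_width_zero (θ : Stage13HParams F N) (hP : θ.Provisos₁₃CoPH F N) (K₀ : ℕ) (g₀ : ℕ → ℝ) (os : List (ULoop F)) {ρ : ℕ → ℝ} (n : ℕ → ℕ)
    {K : ℕ} (hρ : ρ K = 0) (t : ℝ) (x : Σ K, SiteSeqKey F (K₀ + K)) : gapShellA₁₃ θ hP K₀ g₀ os ρ n K t x = 0 := by
  letI : ∀ Kc, DecidableEq (SiteSeqKey F Kc) := fun _ => Classical.decEq _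
  unfold gapShellA₁₃
  refine Finset.sum_eq_zero fun s _ => ?_
  rw [hρ, cutGrid_width_zero, cutGrid_width_zero, cutGrid_width_zero]
  exact topGapShellAtLevel_self_eq_zero F N θ.toStage9Params (datumOfRecord₁₃CoPH F N θ hP) g₀ os (runA₁₃ F K₀ g₀ K) (histA₁₃ θ K₀ g₀ K) _ t _
    (YMDAG.UVSplit.runA₁₃_K F K₀ g₀ K).symm s

/-- ★ **… AND RUN B's.** [bookkeeping] -/
theorem gapShellB₁₃_eq_zero_of_width_zero (θ : Stage13HParams F N) (hP : θ.Provisos₁₃CoPH F N) (K₀ : ℕ) (g₀ : ℕ → ℝ) (os : List (ULoop F)) {ρ : ℕ → ℝ} (n : ℕ → ℕ)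
    {K : ℕ} (hρ : ρ K = 0) (t : ℝ) (x : Σ K, SiteSeqKey F (K₀ + K)) : gapShellB₁₃ θ hP K₀ g₀ os ρ n K t x = 0 := by
  letI : ∀ Kc, DecidableEq (SiteSeqKey F Kc) := fun _ => Classical.decEq _
  unfold gapShellB₁₃
  refine Finset.sum_eq_zero fun s' _ => ?_
  rw [hρ, cutGrid_width_zero, cutGrid_width_zero, cutGrid_width_zero]
  exact topGapShellAtLevel_self_eq_zero F N θ.toStage9Params (datumOfRecord₁₃CoPH F N θ hP) g₀ os (runB₁₃ F K₀ g₀ K) (histB₁₃ θ K₀ g₀ K) _ t _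
    (YMDAG.UVSplit.runB₁₃_K F K₀ g₀ K).symm s'

/-- **DEPTH BUDGET `0` SELECTS DEPTH `0`** — the selected middle letter is then `ε(1 − ρ_K)` and the collar is `(ε(1 − ρ_K)², ε)`. [bookkeeping] -/
theorem selGapDepth₁₃_budget_zero (θ : Stage13HParams F N) (hP : θ.Provisos₁₃CoPH F N) (K₀ : ℕ) (g₀ : ℕ → ℝ) (os : List (ULoop F)) (ρ : ℕ → ℝ) (K : ℕ) (t : ℝ) :
    selGapDepth₁₃ θ hP K₀ g₀ os ρ 0 K t = 0 :=
  Nat.le_zero.1 (selGapDepth₁₃_le θ hP K₀ g₀ os ρ 0 K t)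

/-! ### The gapped reading shares every non-weight field with dag-n20-d's `crOfRecord₁₃VAt` (`rfl`) -/

section Dictionary

variable (K₀ : ℕ) (jcut : ℕ → ℕ) (sh : ShellSplit₁₃CoPH N K₀) (ρ : WidthLetter₁₃CoPH N) (n : DepthLetter₁₃CoPH N) (θ : Stage13HParams F N)
  (hP : θ.Provisos₁₃CoPH F N) (g₀ : ℕ → ℝ) (os : List (ULoop F))

/-- same class set. [bookkeeping] -/
theorem crGap₁₃VAt_T_eq : (crGap₁₃VAt N K₀ jcut ρ n F θ hP g₀ os).T = (crOfRecord₁₃VAt K₀ jcut sh F θ hP g₀ os).T := rfl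
/-- same bad class. [bookkeeping] -/
theorem crGap₁₃VAt_Bad_eq : (crGap₁₃VAt N K₀ jcut ρ n F θ hP g₀ os).Bad = (crOfRecord₁₃VAt K₀ jcut sh F θ hP g₀ os).Bad := rfl
/-- same volume letter. [bookkeeping] -/
theorem crGap₁₃VAt_vol_eq : (crGap₁₃VAt N K₀ jcut ρ n F θ hP g₀ os).vol = (crOfRecord₁₃VAt K₀ jcut sh F θ hP g₀ os).vol := rfl
/-- same `l₀`. [bookkeeping] -/
theorem crGap₁₃VAt_l₀_eq : (crGap₁₃VAt N K₀ jcut ρ n F θ hP g₀ os).l₀ = (crOfRecord₁₃VAt K₀ jcut sh F θ hP g₀ os).l₀ := rfl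
/-- same offset. [bookkeeping] -/
theorem crGap₁₃VAt_K₀_eq : (crGap₁₃VAt N K₀ jcut ρ n F θ hP g₀ os).K₀ = (crOfRecord₁₃VAt K₀ jcut sh F θ hP g₀ os).K₀ := rfl

/-- ★★ **THE GAPPED READING's CORES `A − shA`, `B − shB` ARE THE KEYED GAPPED CORES** `gapCoreA₁₃ ∕ gapCoreB₁₃` (U5), identically: what `KeyedCoreEdgeHolderD4`-shaped consumers
match at this reading — the (2.18) terms with NO top cube statistic in the selected open collar. [bookkeeping] -/
theorem crGap₁₃VAt_core_eq (K : ℕ) (t : ℝ) (x : Σ K, SiteSeqKey F (K₀ + K)) :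
    (crGap₁₃VAt N K₀ jcut ρ n F θ hP g₀ os).A K t x - (crGap₁₃VAt N K₀ jcut ρ n F θ hP g₀ os).shA K t x =
        gapCoreA₁₃ θ hP K₀ g₀ os (ρ F θ hP g₀ os) (n F θ hP g₀ os) K t x ∧
      (crGap₁₃VAt N K₀ jcut ρ n F θ hP g₀ os).B K t x - (crGap₁₃VAt N K₀ jcut ρ n F θ hP g₀ os).shB K t x =
        gapCoreB₁₃ θ hP K₀ g₀ os (ρ F θ hP g₀ os) (n F θ hP g₀ os) K t x :=
  ⟨gapWeightA₁₃_sub_gapShellA₁₃ θ hP K₀ g₀ os _ _ K t x, gapWeightB₁₃_sub_gapShellB₁₃ θ hP K₀ g₀ os _ _ K t x⟩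

end Dictionary

end Reading

end Summit.QuantumFields.YangMills.Theorems.N21ShellSplitOfRecord13CoPH

end
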